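import Mathlib
import Literature.Computability.AlgebraicComplexity.PIProof

/-!
# Crux `RestorationQP` (stmt-ValiantsHypothesis-10343), line `registered`: the proof-calculus
rungs under stub T′ `stub_invarianceProvableQP'`

Stub T′ (conjecture-grade: Hrubeš–Tzameret 2009 §1, p-boundedness of `P_c` is open) asks, for a
circuit `C` over the matrix variables `x_ab` (`a, b < n`), for `P_c(ℂ)` proofs
(`HasPCProofOfSize`, Hrubeš–Tzameret arXiv:1112.6265 §1.1) of ALL the invariance identities
`C ∘ σ = C`, `σ ∈ S_n` (diagonal relabelling `x_ab ↦ x_{σ a, σ b}`).  Any construction of such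
proofs produces them for GENERATORS of `S_n` and closes under products; this file lands that
bookkeeping once and for all: for a FIXED circuit `C`, the `σ` whose invariance identity is
provable form a submonoid of `S_n`, with an additive size calculus.

* `piCircuit_rename_id`, `piCircuit_rename_rename` — functoriality of `PICircuit.rename`.
* H1 `invarianceProvableQP_aux_rename_one` — `C ∘ 1 = C` is the axiom A1, size `2|C|`.
* H2 `invarianceProvableQP_aux_rename_mul` — proofs for `σ` (size `t₁`) and `τ` (size `t₂`)
  give one for `σ * τ` of size `t₁ + t₂ + 2|C|`: rename the `τ`-proof along `σ`
  (`HasPCProofOfSize.rename`, same size) and chain with the `σ`-proof by R2.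
* `hasPCProofOfSize_rename_perm_of_swap` — proofs of size `≤ t` for all transpositions `(i j)`,
  `i < j`, give proofs for every `σ ∈ S_n` of size `≤ (n + 1) (t + 2|C|)` (induction on the
  support of `σ`, `Equiv.Perm.card_support_swap_mul`).
* `hasPCProofOfSize_rename_swap_of_adjacent` — proofs of size `≤ t` for the ADJACENT
  transpositions `(i i+1)` give proofs for all transpositions of size `≤ 2 n (t + 2|C|)`
  (`(i j+1) = (j j+1)(i j)(j j+1)`, `Equiv.swap_mul_swap_mul_swap`).
* `hasPCProofOfSize_rename_perm_of_adjacent` — hence proofs for every `σ ∈ S_n` of size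
  `≤ 2 (n + 1)² (t + 2|C|)`: the word-length rung (H3) reducing the all-`σ` hypothesis of the
  stability stubs S2/L to the `n - 1` adjacent transpositions at polynomial cost.
-/

-- single-problem summit: `Summit.ValiantsHypothesis.ValiantsHypothesis.…` is the namespace by design (D-0017)
set_option linter.dupNamespace false

namespace Summit.ValiantsHypothesis.ValiantsHypothesis.Theorems

open MvPolynomial Literature.Computability.AlgebraicComplexity

universe u v w w'

/-! ### Functoriality of renaming -/

section Functoriality

variable {𝔽 : Type u} {X : Type v} {Y : Type w} {Z : Type w'}

/-- Renaming a node along `id` does nothing. [folklore] -/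
theorem piCircuit_node_rename_id (p : PICircuit.Node 𝔽 X) : p.rename id = p := by
  cases p <;> rfl

/-- Renaming a node along `f` and then along `g` is renaming along `g ∘ f`. [folklore] -/
theorem piCircuit_node_rename_rename (f : X → Y) (g : Y → Z) (p : PICircuit.Node 𝔽 X) :
    (p.rename f).rename g = p.rename (g ∘ f) := by
  cases p <;> rfl

/-- `PICircuit.rename id = id`. [folklore] -/
theorem piCircuit_rename_id (C : PICircuit 𝔽 X) : C.rename id = C := by
  obtain ⟨body, out⟩ := C
  simp only [PICircuit.rename, List.map_id'' piCircuit_node_rename_id, piCircuit_node_rename_id]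

/-- `(C.rename f).rename g = C.rename (g ∘ f)`. [folklore] -/
theorem piCircuit_rename_rename (f : X → Y) (g : Y → Z) (C : PICircuit 𝔽 X) :
    (C.rename f).rename g = C.rename (g ∘ f) := by
  have h : (PICircuit.Node.rename (𝔽 := 𝔽) g ∘ PICircuit.Node.rename f) =
      PICircuit.Node.rename (g ∘ f) :=
    funext (piCircuit_node_rename_rename f g)
  obtain ⟨body, out⟩ := C
  simp only [PICircuit.rename, List.map_map, h, piCircuit_node_rename_rename]

end Functoriality

/-! ### The submonoid of provable invariance identities of a fixed circuit -/

/-- **H1 — the unit.** `C ∘ 1 = C` is (after `one_smul`, `rename id = id`) the axiom A1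
`C = C`: a one-line `P_c(ℂ)` proof of size `|C| + |C|`. [folklore] -/
theorem invarianceProvableQP_aux_rename_one : ∀ (n : ℕ) (C : PICircuit ℂ (Fin n × Fin n)), HasPCProofOfSize (C.rename fun x : Fin n × Fin n => (1 : Equiv.Perm (Fin n)) • x) C (2 * C.size) := by
  intro n C
  have h1 : (fun x : Fin n × Fin n => (1 : Equiv.Perm (Fin n)) • x) = id :=
    funext fun x => one_smul _ x
  rw [h1, piCircuit_rename_id]
  refine PISystem.Provable.mono (PISystem.Provable.refl (S := pcSystem ℂ (Fin n × Fin n)) C) ?_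
    fun _ => le_top
  have h : C.size + C.size ≤ 2 * C.size := by omega
  exact_mod_cast h

/-- **H2 — products.** From `P_c(ℂ)` proofs of `C ∘ σ = C` (size `≤ t₁`) and `C ∘ τ = C`
(size `≤ t₂`): renaming the second along `σ` gives `C ∘ (σ τ) = C ∘ σ` with the same size
(`P_c` proofs are closed under renaming of the variables), and R2 chains it with the first into
`C ∘ (σ τ) = C`, of size `≤ t₁ + t₂ + |C ∘ (στ)| + |C| = t₁ + t₂ + 2|C|`. [folklore] -/
theorem invarianceProvableQP_aux_rename_mul : ∀ (n t₁ t₂ : ℕ) (C : PICircuit ℂ (Fin n × Fin n)) (σ τ : Equiv.Perm (Fin n)), HasPCProofOfSize (C.rename fun x : Fin n × Fin n => σ • x) C t₁ → HasPCProofOfSize (C.rename fun x : Fin n × Fin n => τ • x) C t₂ → HasPCProofOfSize (C.rename fun x : Fin n × Fin n => (σ * τ) • x) C (t₁ + t₂ + 2 * C.size) := by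
  intro n t₁ t₂ C σ τ hσ hτ
  have hτ' := hτ.rename fun x : Fin n × Fin n => σ • x
  rw [piCircuit_rename_rename] at hτ'
  have hcomp : ((fun x : Fin n × Fin n => σ • x) ∘ fun x : Fin n × Fin n => τ • x) =
      fun x : Fin n × Fin n => (σ * τ) • x :=
    funext fun x => (mul_smul σ τ x).symm
  rw [hcomp] at hτ'
  have key : (pcSystem ℂ (Fin n × Fin n)).Provable (C.rename fun x : Fin n × Fin n => (σ * τ) • x) C
      ((t₂ : ℕ∞) + t₁ + ((C.rename fun x : Fin n × Fin n => (σ * τ) • x).size + C.size : ℕ))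
      (⊤ + ⊤) :=
    PISystem.Provable.trans hτ' hσ
  refine PISystem.Provable.mono key ?_ fun _ => le_top
  rw [PICircuit.size_rename]
  have h : t₂ + t₁ + (C.size + C.size) ≤ t₁ + t₂ + 2 * C.size := by omega
  exact_mod_cast h

/-! ### Word length: from generators to all of `S_n` at polynomial cost -/

/-- Proofs of `C ∘ (i j) = C` of size `≤ t` for all transpositions `(i j)`, `i < j`, give for
every `σ ∈ S_n` a proof of `C ∘ σ = C` of size `≤ (#supp σ + 1) (t + 2|C|)`: write
`σ = (x σx) · τ` with `#supp τ < #supp σ` and use H1/H2. [folklore] -/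
theorem hasPCProofOfSize_rename_perm_of_swap_card {n : ℕ} (t : ℕ) (C : PICircuit ℂ (Fin n × Fin n))
    (h : ∀ i j : Fin n, i < j →
      HasPCProofOfSize (C.rename fun x : Fin n × Fin n => Equiv.swap i j • x) C t)
    (σ : Equiv.Perm (Fin n)) :
    HasPCProofOfSize (C.rename fun x : Fin n × Fin n => σ • x) C
      ((σ.support.card + 1) * (t + 2 * C.size)) := by
  -- any transposition, in either order of its entries, has a proof of size `≤ t`
  have hswap : ∀ i j : Fin n, i ≠ j →
      HasPCProofOfSize (C.rename fun x : Fin n × Fin n => Equiv.swap i j • x) C t := by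
    intro i j hij
    rcases hij.lt_or_gt with hlt | hgt
    · exact h i j hlt
    · rw [Equiv.swap_comm]; exact h j i hgt
  suffices H : ∀ (k : ℕ) (σ : Equiv.Perm (Fin n)), σ.support.card ≤ k →
      HasPCProofOfSize (C.rename fun x : Fin n × Fin n => σ • x) C
        ((σ.support.card + 1) * (t + 2 * C.size)) from H _ σ le_rfl
  intro k
  induction k with
  | zero =>
    intro σ hσ
    have h1 : σ = 1 := Equiv.Perm.card_support_eq_zero.1 (Nat.le_zero.1 hσ)
    subst h1
    exact (invarianceProvableQP_aux_rename_one n C).mono (by nlinarith)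
  | succ k ih =>
    intro σ hσ
    by_cases h1 : σ = 1
    · subst h1
      exact (invarianceProvableQP_aux_rename_one n C).mono (by nlinarith)
    · have hne : σ.support ≠ ∅ := fun he => h1 (Equiv.Perm.support_eq_empty_iff.1 he)
      obtain ⟨x, hx⟩ := Finset.nonempty_iff_ne_empty.2 hne
      rw [Equiv.Perm.mem_support] at hx
      set τ : Equiv.Perm (Fin n) := Equiv.swap x (σ x) * σ with hτ
      have hcard : τ.support.card < σ.support.card := Equiv.Perm.card_support_swap_mul hx
      have hτpf := ih τ (by omega)
      have hσeq : Equiv.swap x (σ x) * τ = σ := Equiv.swap_mul_self_mul x (σ x) σ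
      have := invarianceProvableQP_aux_rename_mul n t _ C (Equiv.swap x (σ x)) τ
        (hswap x (σ x) hx.symm) hτpf
      rw [hσeq] at this
      refine this.mono ?_
      have hle : τ.support.card + 2 ≤ σ.support.card + 1 := by omega
      calc t + (τ.support.card + 1) * (t + 2 * C.size) + 2 * C.size
          = (τ.support.card + 2) * (t + 2 * C.size) := by ring
        _ ≤ (σ.support.card + 1) * (t + 2 * C.size) := Nat.mul_le_mul_right _ hle

/-- **Transpositions suffice.** Proofs of `C ∘ (i j) = C` of size `≤ t` for all transpositions
`(i j)`, `i < j`, give for every `σ ∈ S_n` a proof of `C ∘ σ = C` of size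
`≤ (n + 1) (t + 2|C|)` (every `σ` is a product of `≤ n` transpositions). [folklore] -/
theorem hasPCProofOfSize_rename_perm_of_swap {n : ℕ} (t : ℕ) (C : PICircuit ℂ (Fin n × Fin n))
    (h : ∀ i j : Fin n, i < j →
      HasPCProofOfSize (C.rename fun x : Fin n × Fin n => Equiv.swap i j • x) C t)
    (σ : Equiv.Perm (Fin n)) :
    HasPCProofOfSize (C.rename fun x : Fin n × Fin n => σ • x) C ((n + 1) * (t + 2 * C.size)) := by
  refine (hasPCProofOfSize_rename_perm_of_swap_card t C h σ).mono (Nat.mul_le_mul_right _ ?_)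
  have := Finset.card_le_univ σ.support
  rw [Fintype.card_fin] at this
  omega

/-- **Adjacent transpositions give all transpositions.** Proofs of `C ∘ (i i+1) = C` of size
`≤ t` for the adjacent transpositions give, for `j = i + 1 + d`, a proof of `C ∘ (i j) = C` of
size `≤ (2 d + 1) (t + 2|C|)`, by `(i j+1) = (j j+1) (i j) (j j+1)` and H2 twice. [folklore] -/
theorem hasPCProofOfSize_rename_swap_of_adjacent_gap {n : ℕ} (t : ℕ) (C : PICircuit ℂ (Fin n × Fin n))
    (h : ∀ i j : Fin n, (j : ℕ) = i + 1 →
      HasPCProofOfSize (C.rename fun x : Fin n × Fin n => Equiv.swap i j • x) C t)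
    (d : ℕ) : ∀ i j : Fin n, (j : ℕ) = i + 1 + d →
      HasPCProofOfSize (C.rename fun x : Fin n × Fin n => Equiv.swap i j • x) C
        ((2 * d + 1) * (t + 2 * C.size)) := by
  induction d with
  | zero =>
    intro i j hij
    exact (h i j hij).mono (by nlinarith)
  | succ d ih =>
    intro i j hij
    -- the intermediate index `j₀ = i + 1 + d`, with `j = j₀ + 1`
    have hj₀ : (i : ℕ) + 1 + d < n := by omega
    set j₀ : Fin n := ⟨(i : ℕ) + 1 + d, hj₀⟩ with hj₀def
    have hij₀ : (j₀ : ℕ) = i + 1 + d := rfl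
    have hj₀j : (j : ℕ) = j₀ + 1 := by rw [hij₀]; omega
    have hmid := ih i j₀ hij₀
    have hadj := h j₀ j hj₀j
    have hne₁ : i ≠ j₀ := fun he => by have := congrArg Fin.val he; rw [hij₀] at this; omega
    have hne₂ : i ≠ j := fun he => by have := congrArg Fin.val he; omega
    -- `(i j) = (j₀ j) (i j₀) (j₀ j)`
    have hconj : Equiv.swap j₀ j * (Equiv.swap i j₀ * Equiv.swap j₀ j) = Equiv.swap i j := by
      rw [← mul_assoc, Equiv.swap_mul_swap_mul_swap hne₁ hne₂, Equiv.swap_comm]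
    have h₁ := invarianceProvableQP_aux_rename_mul n _ _ C (Equiv.swap i j₀) (Equiv.swap j₀ j) hmid hadj
    have h₂ := invarianceProvableQP_aux_rename_mul n _ _ C (Equiv.swap j₀ j) _ hadj h₁
    rw [hconj] at h₂
    refine h₂.mono (le_of_eq ?_)
    ring

/-- **Adjacent transpositions give all transpositions**, with the uniform bound
`2 n (t + 2|C|)`. [folklore] -/
theorem hasPCProofOfSize_rename_swap_of_adjacent {n : ℕ} (t : ℕ) (C : PICircuit ℂ (Fin n × Fin n))
    (h : ∀ i j : Fin n, (j : ℕ) = i + 1 →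
      HasPCProofOfSize (C.rename fun x : Fin n × Fin n => Equiv.swap i j • x) C t)
    (i j : Fin n) (hij : i < j) :
    HasPCProofOfSize (C.rename fun x : Fin n × Fin n => Equiv.swap i j • x) C
      (2 * n * (t + 2 * C.size)) := by
  have hlt : (i : ℕ) < j := hij
  have hd : (j : ℕ) = i + 1 + ((j : ℕ) - i - 1) := by omega
  refine (hasPCProofOfSize_rename_swap_of_adjacent_gap t C h _ i j hd).mono
    (Nat.mul_le_mul_right _ ?_)
  have := j.isLt
  omega

/-- **H3 — word length.** Proofs of `C ∘ (i i+1) = C` of size `≤ t` for the `n - 1` adjacent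
transpositions of `Fin n` give, for EVERY `σ ∈ S_n`, a `P_c(ℂ)` proof of `C ∘ σ = C` of size
`≤ 2 (n + 1)² (t + 2|C|)`: the all-`σ` hypothesis of the stability stubs (S2, L) costs only a
polynomial factor over the generator hypothesis a proof of T′ would naturally establish.
[folklore] -/
theorem hasPCProofOfSize_rename_perm_of_adjacent {n : ℕ} (t : ℕ) (C : PICircuit ℂ (Fin n × Fin n))
    (h : ∀ i j : Fin n, (j : ℕ) = i + 1 →
      HasPCProofOfSize (C.rename fun x : Fin n × Fin n => Equiv.swap i j • x) C t)
    (σ : Equiv.Perm (Fin n)) :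
    HasPCProofOfSize (C.rename fun x : Fin n × Fin n => σ • x) C
      (2 * (n + 1) ^ 2 * (t + 2 * C.size)) := by
  have hsw := hasPCProofOfSize_rename_swap_of_adjacent t C h
  refine (hasPCProofOfSize_rename_perm_of_swap (2 * n * (t + 2 * C.size)) C
    (fun i j hij => hsw i j hij) σ).mono ?_
  have h1 : 2 * n * (t + 2 * C.size) + 2 * C.size ≤ 2 * (n + 1) * (t + 2 * C.size) := by nlinarith
  calc (n + 1) * (2 * n * (t + 2 * C.size) + 2 * C.size)
      ≤ (n + 1) * (2 * (n + 1) * (t + 2 * C.size)) := Nat.mul_le_mul_left _ h1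
    _ = 2 * (n + 1) ^ 2 * (t + 2 * C.size) := by ring

end Summit.ValiantsHypothesis.ValiantsHypothesis.Theorems
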